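import Mathlib
import HarnessLib
import Summits.Langlands.Langlands.Theses.EisensteinGelfandKirillov
import Literature.NumberTheory.GaloisRepresentations.Pseudocharacter

/-!
# Route `EisensteinGelfandKirillov`, crux `ProModularOfGKBound` (stmt-Langlands-18273): vocabulary of
# the line `two-leaf-fern`

Route-posited objects (D-0016 `<Route><Crux>Defs`-type file; same convention as
`EisensteinGelfandKirillovProModularOfGKBoundDefs.lean`, which carries the vocabulary of the sibling line
`eisenstein-fern`) shared by the five registered stubs of the checked skeleton
`Cruxes/ProModularOfGKBound/Lines/two_leaf_fern.lean` (lead copy of lead c2, 2026-08-17, stubs `stub_host`,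
`stub_noetherian`, `stub_closure`, `stub_fernCapture`, `stub_seed`) and by the crux file that will compose
them.  NOTHING IS ASSERTED: `badSet`, `proModularIdeal`, `IsGoodPoint` are transparent definitions over tree
declarations, `Host` is a `Type`-valued INTERFACE (a structure of data + properties; its inhabitation is the
separate stub `stub_host`), and the lemmas at the end are proved.  Declared in the skeleton's namespace
`Summit.Langlands.Langlands.Cruxes.ProModularOfGKBound.TwoLeafFern`, so that a landed stub
`theorem stub_<name> : <registered signature>` reads byte-identically to its registration.

Objects (`badSet`, `proModularIdeal`, `IsGoodPoint` verbatim from the planner's checked skeleton,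
planner-cruxplan-stmt-Langlands-18273-two-leaf-fern-0, 2026-08-17; `Host` RESHAPED by the lead, see its
docstring; line card `Cruxes/ProModularOfGKBound/Lines/two-leaf-fern.md`):

* `badSet p ρ` — the ramified places of `ρ` together with the places above `p`;
* `proModularIdeal R T 𝒰` — the ideal `J_𝒰 ⊆ R` of the `𝒰`-pro-modular points of a ring `R` carrying a trace
  function `T : Γ_F → R` ([cite: Chenevier2011, §1], the Zariski closure of the modular locus is `V(J_𝒰)`);
* `IsGoodPoint p ρz` — a `p`-adic twist of a strongly irreducible, nearly ordinary, labelled-Hodge–Tate-regular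
  CLASSICAL `ρ_c` ([cite: NewtonThorne2019, Thm 2 (Thm 5.6 for GL₂ over totally real F)]);
* `Host p O ρ ρ₀` — the pseudo-deformation host of `ρ` as an interface: a compact Hausdorff local ring `R` with
  `p ∈ 𝔪_R`, a continuous `2`-dimensional pseudocharacter `T : Γ_F → R` whose values topologically generate `R`,
  unramified outside `badSet p ρ`, with Galois-equivariantly fixed determinant, a base point specialising `T` to
  `tr ρ`, and the universality clause (U2) ([cite: Chenevier2014, §3 (universal deformation ring of a
  determinant)], [cite: BellaicheChenevier2009, §1.4]).
-/

set_option linter.dupNamespace false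
set_option autoImplicit false

noncomputable section

open scoped NumberField Matrix
open Filter Field IsDedekindDomain
open Literature.NumberTheory.GaloisRepresentations Literature.NumberTheory.Automorphic
open Literature.NumberTheory.Automorphic.BigHeckeGLn

namespace Summit.Langlands.Langlands.Cruxes.ProModularOfGKBound.TwoLeafFern

/-! ## Transparent definitions (verbatim from the planner's skeleton) -/

/-- The exceptional set `S` of the host attached to `ρ`: the finite places where `ρ` is ramified,
together with the places above `p` (finite under the crux hypothesis `∀ᶠ v in cofinite, ρ.IsUnramifiedAt v`).
[folklore] -/
def badSet {F : Type} [Field F] [NumberField F] (p : ℕ) [Fact p.Prime]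
    (ρ : FramedGaloisRep F (PadicAlgCl p) 2) : Set (HeightOneSpectrum (𝓞 F)) :=
  {v | ¬ ρ.IsUnramifiedAt v ∨ ((p : ℕ) : 𝓞 F) ∈ v.asIdeal}

/-- **The ideal of the `𝒰`-pro-modular points** `J_𝒰 ⊆ R` of a ring `R` carrying a trace function
`T : Γ_F → R`: the intersection of the kernels of the continuous points `x : R → ℚ̄_p` whose trace function
`x ∘ T` is the trace of a `𝒰`-pro-modular (`TameLevel.IsPadicallyAutomorphic`) representation
`Γ_F → GL₂(ℚ̄_p)`.  `V(J_𝒰)` is the Zariski closure of the pro-modular locus (Gouvêa–Mazur's "modular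
locus", Chenevier's `𝔛^{mod}`). [cite: Chenevier2011, §1 (𝔛^{mod})] -/
def proModularIdeal {F : Type} [Field F] [NumberField F] {p : ℕ} [Fact p.Prime]
    (R : Type) [CommRing R] [TopologicalSpace R] (T : absoluteGaloisGroup F → R)
    (𝒰 : TameLevel 2 F p) : Ideal R :=
  ⨅ (x : R →+* PadicAlgCl p) (_ : Continuous x ∧
      ∃ ρz : FramedGaloisRep F (PadicAlgCl p) 2,
        (∀ g, x (T g) = ((ρz g : GL (Fin 2) (PadicAlgCl p)) : Matrix (Fin 2) (Fin 2) (PadicAlgCl p)).trace) ∧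
        𝒰.IsPadicallyAutomorphic ρz),
    RingHom.ker x

/-- **Good points** of the fern: `ρ_z = η ⊗ ρ_c` is a continuous `p`-adic twist of a framed
`ρ_c : Γ_F → GL₂(ℚ̄_p)` which is
(i) CLASSICAL — Satake–Frobenius compatible at almost all places with an L-algebraic cuspidal `π` on
`GL₂(𝔸_F)` (the tree's `Summit.Langlands.SatakeFrobCompatibleAt`, as in the route's target);
(ii) STRONGLY IRREDUCIBLE — irreducible on `Γ_L` for every number field `L ⊇ F` (= non-CM for Hilbert
eigenforms), the hypothesis of Newton–Thorne Thm 2 and the exclusion of finite-image (weight-one) points;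
(iii) at every `v ∣ p`: NEARLY ORDINARY (some frame of `ρ_c|_{Γ_{F_v}}` is upper triangular) and
labelled-Hodge–Tate REGULAR for Fontaine's pinned datum (verbatim the clause of the route's target and exit crux).
[cite: NewtonThorne2019, Thm 2 (Thm 5.6 for GL₂ over totally real F)] [cite: Chenevier2011, Thm E and §3] -/
def IsGoodPoint {F : Type} [Field F] [NumberField F] (p : ℕ) [Fact p.Prime]
    (ρz : FramedGaloisRep F (PadicAlgCl p) 2) : Prop :=
  ∃ (ρc : FramedGaloisRep F (PadicAlgCl p) 2) (η : absoluteGaloisGroup F →ₜ* (PadicAlgCl p)ˣ),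
    (∀ g, ((ρz g : GL (Fin 2) (PadicAlgCl p)) : Matrix (Fin 2) (Fin 2) (PadicAlgCl p)) =
      ((η g : (PadicAlgCl p)ˣ) : PadicAlgCl p) •
        ((ρc g : GL (Fin 2) (PadicAlgCl p)) : Matrix (Fin 2) (Fin 2) (PadicAlgCl p))) ∧
    (∃ (hcpt : isCompact_glFiniteIntegralLevel 2 F) (ι : PadicAlgCl p ≃+* ℂ)
        (π : CuspidalAutomorphicRepData 2 F hcpt),
      π.1.IsLAlgebraic ∧ ∀ᶠ v in cofinite, Summit.Langlands.SatakeFrobCompatibleAt ι π.1 ρc v) ∧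
    (∀ (L : Type) [Field L] [NumberField L] [Algebra F L],
      (ρc.restrictField L).toGaloisRep.IsIrreducible) ∧
    (∀ (v : HeightOneSpectrum (𝓞 F)) (hv : ((p : ℕ) : 𝓞 F) ∈ v.asIdeal),
      (∃ Q : GL (Fin 2) (PadicAlgCl p), ∀ σ,
        ((Q⁻¹ * ρc.toLocal v σ * Q : GL (Fin 2) (PadicAlgCl p)) : Matrix (Fin 2) (Fin 2) (PadicAlgCl p)) 1 0 = 0) ∧
      (letI := (Literature.NumberTheory.PAdicHodge.fontainePstAdicCompletion v p hv).algebra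
       Literature.NumberTheory.GaloisRepresentations.GaloisRep.IsLabelledHodgeTateRegular
         (Literature.NumberTheory.PAdicHodge.fontainePstAdicCompletion v p hv).𝔅 (ρc.toLocal v).toGaloisRep))

/-! ## The host (interface; RESHAPED by the lead) -/

/-- **The host: a fixed-determinant pseudo-deformation space for `ρ`, as an interface** (existence is the
separate statement `stub_host`; nothing here asserts it).

Data: a commutative ring `R` which is a compact Hausdorff topological ring, local, with `p ∈ 𝔪_R` (so every
integer prime to `p` is a unit, `isUnit_natCast_of_coprime`); a continuous `2`-dimensional pseudocharacter
`T : Γ_F → R` (tree `ContinuousPseudocharacter`) whose values TOPOLOGICALLY GENERATE `R` (G) — hence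
continuous points `R → ℚ̄_p` are separated by their trace functions (`Host.separating`, the planner's (U1));
(U0) `unramified`: `T` is unramified outside `badSet p ρ` (inertia in Taylor's kernel);
(D) `det_point`: the determinant is FIXED, Galois-equivariantly — every continuous point `x` has determinant
function `σ ∘ det ρ` for some `σ ∈ Gal(ℚ̄_p/ℚ_p)` (`x(T g)² − x(T g²) = 2 σ(det ρ g)`);
the BASE POINT `base : R → ℚ̄_p`, continuous, with `base ∘ T = tr ρ`;
(U2) `exists_point`: every continuous `ρ' : Γ_F → GL₂(ℚ̄_p)` admitting an `O`-integral model `ρ'₀` in the same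
frame whose traces are congruent to those of `ρ₀` modulo `𝔪_O`, whose determinant EQUALS `det ρ₀`, and which
is unramified outside `badSet p ρ`, is a continuous point.

Intended instances: `R = R^{ps,ψ}_{τ̄,S} ⊗ 𝒪_E`, the universal deformation ring of the pseudocharacter
`τ̄ = tr(ρ₀ mod 𝔪_O)` of `G_{F,S}` with determinant `ψ = det ρ₀` [cite: Chenevier2014, §3 (universal
deformation ring of a determinant)] [cite: BellaicheChenevier2009, §1.4] [cite: Pan2022, §7.1], or — what
`stub_host` constructs — its image `R_tr` in `∏_{ρ'} 𝒪_{E_{ρ'}}` over all lifts `ρ'` as in (U2) (the closed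
subring generated by the families of traces).

RESHAPE (lead c2, 2026-08-17) of the planner's `Host`: (1) the planner's (D) asked `x(T g)² − x(T g²) = 2·det ρ(g)`
for EVERY continuous point `x`; since `σ ∘ base` is a continuous point for every `σ ∈ Gal(ℚ̄_p/ℚ_p)`
(automorphisms of `PadicAlgCl p` are spectral-norm isometries), that clause forces `det ρ(Γ_F) ⊆ ℚ_p` and is
unsatisfiable otherwise — (D) is now Galois-equivariant; (2) the planner's (U1) "points separated by traces"
is replaced by the intrinsic (G), which implies it; (3) `IsNoetherianRing R` is no longer a field: it is the
content of the separate stub `stub_noetherian` (Φ_p-finiteness of `G_{F,S}` ⇒ the universal pseudo-deformation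
ring is Noetherian and surjects onto every trace-generated host).  Irreducibility, oddness and
`p`-distinguishedness of `ρ` are NOT needed and not assumed. -/
structure Host {F : Type} [Field F] [NumberField F] (p : ℕ) [Fact p.Prime]
    (O : ValuationSubring (PadicAlgCl p)) (ρ : FramedGaloisRep F (PadicAlgCl p) 2)
    (ρ₀ : absoluteGaloisGroup F →* GL (Fin 2) O) : Type 1 where
  /-- The coefficient ring `R` of the host (intended `R^{ps,ψ}_{τ̄,S}`, or the trace algebra `R_tr`). -/
  R : Type
  [commRing : CommRing R]
  [topologicalSpace : TopologicalSpace R]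
  [isTopologicalRing : IsTopologicalRing R]
  [compactSpace : CompactSpace R]
  [t2Space : T2Space R]
  [isLocalRing : IsLocalRing R]
  /-- `p ∈ 𝔪_R` (residue characteristic `p`). -/
  mem_maximalIdeal : ((p : ℕ) : R) ∈ IsLocalRing.maximalIdeal R
  /-- The universal pseudocharacter `T : Γ_F → R`, continuous of dimension `2`. -/
  T : ContinuousPseudocharacter (absoluteGaloisGroup F) R 2
  /-- (G) the values of `T` topologically generate `R`. -/
  traces_dense : (Subring.closure (Set.range (T : absoluteGaloisGroup F → R))).topologicalClosure = ⊤
  /-- (U0) `T` is unramified outside `S = badSet p ρ`: inertia at `v ∉ S` lies in Taylor's kernel. -/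
  unramified : ∀ v, v ∉ badSet p ρ → ∀ 𝔓 ∈ v.primesAbove,
    ∀ σ ∈ 𝔓.inertia (absoluteGaloisGroup F), ∀ g, T (g * σ) = T g
  /-- (D) FIXED DETERMINANT, Galois-equivariantly: every continuous point has determinant function
  `σ ∘ det ρ` for some `σ ∈ Gal(ℚ̄_p/ℚ_p)` (`2 det = tr² − tr ∘ sq`). -/
  det_point : ∀ x : R →+* PadicAlgCl p, Continuous x →
    ∃ σ : PadicAlgCl p ≃ₐ[ℚ_[p]] PadicAlgCl p, ∀ g,
      x (T g) ^ 2 - x (T (g * g)) =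
        2 * σ ((ρ g : GL (Fin 2) (PadicAlgCl p)) : Matrix (Fin 2) (Fin 2) (PadicAlgCl p)).det
  /-- The base point `x_ρ : R → ℚ̄_p`. -/
  base : R →+* PadicAlgCl p
  continuous_base : Continuous base
  /-- `x_ρ ∘ T = tr ρ`. -/
  base_spec : ∀ g, base (T g) =
    ((ρ g : GL (Fin 2) (PadicAlgCl p)) : Matrix (Fin 2) (Fin 2) (PadicAlgCl p)).trace
  /-- (U2) Every residually-`τ̄`, determinant-`ψ`, `S`-unramified continuous lift is a continuous point. -/
  exists_point : ∀ (ρ' : FramedGaloisRep F (PadicAlgCl p) 2)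
      (ρ'₀ : absoluteGaloisGroup F →* GL (Fin 2) O),
    (∀ g, Matrix.GeneralLinearGroup.map O.subtype (ρ'₀ g) = ρ' g) →
    (∀ g, (ρ'₀ g).val.trace - (ρ₀ g).val.trace ∈ IsLocalRing.maximalIdeal O) →
    (∀ g, (ρ'₀ g).val.det = (ρ₀ g).val.det) →
    (∀ v, v ∉ badSet p ρ → ρ'.IsUnramifiedAt v) →
    ∃ x : R →+* PadicAlgCl p, Continuous x ∧
      ∀ g, x (T g) = ((ρ' g : GL (Fin 2) (PadicAlgCl p)) : Matrix (Fin 2) (Fin 2) (PadicAlgCl p)).trace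

attribute [instance] Host.commRing Host.topologicalSpace Host.isTopologicalRing Host.compactSpace
  Host.t2Space Host.isLocalRing

/-! ## API lemmas (proved) -/

/-- Monotonicity of `badSet` membership: a place outside `badSet p ρ` is a place of unramifiedness of `ρ`
not above `p`. [folklore] -/
theorem not_mem_badSet_iff {F : Type} [Field F] [NumberField F] (p : ℕ) [Fact p.Prime]
    (ρ : FramedGaloisRep F (PadicAlgCl p) 2) (v : HeightOneSpectrum (𝓞 F)) :
    v ∉ badSet p ρ ↔ ρ.IsUnramifiedAt v ∧ ((p : ℕ) : 𝓞 F) ∉ v.asIdeal := by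
  simp only [badSet, Set.mem_setOf_eq, not_or, not_not]

/-- Under the crux hypothesis "`ρ` is unramified at almost every place", `badSet p ρ` is finite (finitely many
places above `p`, `BigHeckeGLn.finite_setOf_natCast_mem_asIdeal`). [folklore] -/
theorem badSet_finite {F : Type} [Field F] [NumberField F] (p : ℕ) [Fact p.Prime]
    {ρ : FramedGaloisRep F (PadicAlgCl p) 2} (hur : ∀ᶠ v in cofinite, ρ.IsUnramifiedAt v) :
    (badSet p ρ).Finite := by
  have h1 : {v : HeightOneSpectrum (𝓞 F) | ¬ ρ.IsUnramifiedAt v}.Finite := by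
    simpa [Filter.eventually_cofinite] using hur
  exact (h1.union (finite_setOf_natCast_mem_asIdeal F p)).subset fun v hv => by
    rcases hv with h | h
    · exact Or.inl h
    · exact Or.inr h

/-- Every place above `p` lies in `badSet p ρ`. [folklore] -/
theorem mem_badSet_of_mem {F : Type} [Field F] [NumberField F] (p : ℕ) [Fact p.Prime]
    (ρ : FramedGaloisRep F (PadicAlgCl p) 2) {v : HeightOneSpectrum (𝓞 F)}
    (hv : ((p : ℕ) : 𝓞 F) ∈ v.asIdeal) : v ∈ badSet p ρ :=
  Or.inr hv

/-- With no pro-modular point at all the pro-modular ideal is `⊤` (empty infimum); conversely the closure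
hypothesis `J_𝒰 ≤ ker x` of `stub_closure` forces `J_𝒰 ≠ ⊤` (a kernel of a map to a field is proper), so that
stub is never vacuously usable. [folklore] -/
theorem proModularIdeal_ne_top_of_le_ker {F : Type} [Field F] [NumberField F] {p : ℕ} [Fact p.Prime]
    (R : Type) [CommRing R] [TopologicalSpace R] (T : absoluteGaloisGroup F → R) (𝒰 : TameLevel 2 F p)
    (x : R →+* PadicAlgCl p) (h : proModularIdeal R T 𝒰 ≤ RingHom.ker x) :
    proModularIdeal R T 𝒰 ≠ ⊤ := by
  intro htop
  rw [htop, top_le_iff] at h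
  exact RingHom.ker_ne_top x h

/-- The pro-modular ideal lies in the kernel of every pro-modular point (it is the infimum of these kernels).
[folklore] -/
theorem proModularIdeal_le_ker {F : Type} [Field F] [NumberField F] {p : ℕ} [Fact p.Prime]
    (R : Type) [CommRing R] [TopologicalSpace R] (T : absoluteGaloisGroup F → R) (𝒰 : TameLevel 2 F p)
    (x : R →+* PadicAlgCl p) (hx : Continuous x) (ρz : FramedGaloisRep F (PadicAlgCl p) 2)
    (hT : ∀ g, x (T g) = ((ρz g : GL (Fin 2) (PadicAlgCl p)) : Matrix (Fin 2) (Fin 2) (PadicAlgCl p)).trace)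
    (hpm : 𝒰.IsPadicallyAutomorphic ρz) :
    proModularIdeal R T 𝒰 ≤ RingHom.ker x :=
  (iInf_le _ x).trans (iInf_le _ ⟨hx, ρz, hT, hpm⟩)

/-- In a local ring with `p ∈ 𝔪`, every natural number prime to `p` is a unit (Bézout: `a n + b p = 1`, and
`1 - b p` is a unit).  Used with `n = 2` and `n = q_v` (`v ∤ p`) by the closure stub. [folklore] -/
theorem isUnit_natCast_of_coprime {R : Type*} [CommRing R] [IsLocalRing R] {p n : ℕ}
    (hp : ((p : ℕ) : R) ∈ IsLocalRing.maximalIdeal R) (hn : n.Coprime p) : IsUnit (n : R) := by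
  by_contra h
  have hn' : ((n : ℕ) : R) ∈ IsLocalRing.maximalIdeal R := (IsLocalRing.mem_maximalIdeal _).2 h
  have h1 : ((1 : ℕ) : R) ∈ IsLocalRing.maximalIdeal R := by
    have hg : Nat.gcd n p = 1 := hn
    obtain ⟨a, b, hab⟩ : ∃ a b : ℤ, (1 : ℤ) = n * a + p * b := by
      refine ⟨Nat.gcdA n p, Nat.gcdB n p, ?_⟩
      have := Nat.gcd_eq_gcd_ab n p
      rw [hg] at this
      exact_mod_cast this
    have : (1 : R) = (n : R) * (a : R) + (p : R) * (b : R) := by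
      have := congrArg (fun z : ℤ => (z : R)) hab
      push_cast at this
      exact this
    rw [Nat.cast_one, this]
    exact Ideal.add_mem _ (Ideal.mul_mem_right _ _ hn') (Ideal.mul_mem_right _ _ hp)
  rw [Nat.cast_one] at h1
  exact (IsLocalRing.maximalIdeal.isMaximal R).ne_top ((Ideal.eq_top_iff_one _).2 h1)

namespace Host

variable {F : Type} [Field F] [NumberField F] {p : ℕ} [Fact p.Prime]
  {O : ValuationSubring (PadicAlgCl p)} {ρ : FramedGaloisRep F (PadicAlgCl p) 2}
  {ρ₀ : absoluteGaloisGroup F →* GL (Fin 2) O}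

/-- (U1) of the planner's interface, now a CONSEQUENCE of (G): continuous points of a host are determined by
their trace functions (ring homomorphisms agreeing on a set agree on the subring it generates, and continuous maps
into a Hausdorff space agreeing on a dense set agree). [folklore] -/
theorem separating (ℋ : Host p O ρ ρ₀) (x y : ℋ.R →+* PadicAlgCl p) (hx : Continuous x) (hy : Continuous y)
    (h : ∀ g, x (ℋ.T g) = y (ℋ.T g)) : x = y := by
  have h1 : Set.EqOn x y (Subring.closure (Set.range (ℋ.T : absoluteGaloisGroup F → ℋ.R))) := by
    intro r hr
    refine Subring.closure_induction (fun z hz => ?_) (by simp) (by simp)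
      (fun a b _ _ ha hb => by rw [map_add, map_add, ha, hb])
      (fun a _ ha => by rw [map_neg, map_neg, ha])
      (fun a b _ _ ha hb => by rw [map_mul, map_mul, ha, hb]) hr
    obtain ⟨g, rfl⟩ := hz
    exact h g
  have h2 : Set.EqOn x y ((Subring.closure (Set.range (ℋ.T : absoluteGaloisGroup F → ℋ.R))).topologicalClosure :
      Set ℋ.R) := by
    change Set.EqOn x y (closure (Subring.closure (Set.range (ℋ.T : absoluteGaloisGroup F → ℋ.R)) : Set ℋ.R))
    exact h1.closure hx hy
  rw [ℋ.traces_dense] at h2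
  exact RingHom.ext fun r => h2 (Subring.mem_top r)

end Host

/-- **(U1) of the planner's interface as a registered sub-goal (`stub_separating`)**: continuous points of a
host are separated by their trace functions — verbatim the planner's `Host.separating` field, now PROVED from
(G) (`Host.separating`).  Registered on the crux item so that the reshape is recorded as preserving (U1).
[folklore] -/
theorem stub_separating : ∀ (F : Type) [Field F] [NumberField F] (p : ℕ) [Fact p.Prime] (O : ValuationSubring (PadicAlgCl p)) (ρ : FramedGaloisRep F (PadicAlgCl p) 2) (ρ₀ : absoluteGaloisGroup F →* GL (Fin 2) O) (ℋ : Host p O ρ ρ₀) (x y : ℋ.R →+* PadicAlgCl p), Continuous x → Continuous y → (∀ g, x (ℋ.T g) = y (ℋ.T g)) → x = y :=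
  fun _ _ _ _ _ _ _ _ ℋ x y hx hy h => ℋ.separating x y hx hy h

namespace Host

variable {F : Type} [Field F] [NumberField F] {p : ℕ} [Fact p.Prime]
  {O : ValuationSubring (PadicAlgCl p)} {ρ : FramedGaloisRep F (PadicAlgCl p) 2}
  {ρ₀ : absoluteGaloisGroup F →* GL (Fin 2) O}

/-- The base point kills no unit: `ker ℋ.base` is a prime ideal, so minimal primes below it exist
(`Ideal.exists_minimalPrimes_le`) — the `∃ P₀` of `stub_seed` ranges over a non-empty set. [folklore] -/
theorem exists_minimalPrime_le_ker_base (ℋ : Host p O ρ ρ₀) :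
    ∃ P₀ ∈ minimalPrimes ℋ.R, P₀ ≤ RingHom.ker ℋ.base := by
  haveI : (RingHom.ker ℋ.base).IsPrime := RingHom.ker_isPrime ℋ.base
  simpa [minimalPrimes] using Ideal.exists_minimalPrimes_le (I := (⊥ : Ideal ℋ.R))
    (J := RingHom.ker ℋ.base) bot_le

/-- `p` lies in no point-kernel of a host: `x p = p ≠ 0` in `ℚ̄_p`; hence a prime below `ker x` does not
contain `p` (it is a point of the generic fibre `Spec R[1/p]`). [folklore] -/
theorem natCast_not_mem_of_le_ker (ℋ : Host p O ρ ρ₀) (x : ℋ.R →+* PadicAlgCl p) {P : Ideal ℋ.R}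
    (hP : P ≤ RingHom.ker x) : ((p : ℕ) : ℋ.R) ∉ P := by
  intro h
  have h0 : x ((p : ℕ) : ℋ.R) = 0 := hP h
  rw [map_natCast] at h0
  exact (Nat.cast_ne_zero.2 (Fact.out : p.Prime).ne_zero) h0

/-- `2` is a unit of a host (`p ≥ 3`; in the line `p ≥ 5`). [folklore] -/
theorem isUnit_two (ℋ : Host p O ρ ρ₀) (hp : 3 ≤ p) : IsUnit (2 : ℋ.R) := by
  have h := isUnit_natCast_of_coprime (R := ℋ.R) (n := 2) ℋ.mem_maximalIdeal ?_
  · simpa using h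
  · exact (Nat.coprime_primes Nat.prime_two (Fact.out : p.Prime)).2 (by omega)

end Host

end Summit.Langlands.Langlands.Cruxes.ProModularOfGKBound.TwoLeafFern

end
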